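import Summits.PneNP.PneNP.Theorems.PositionalGamesParityMonotoneQuasipolyUpperSound
import Summits.PneNP.PneNP.Theorems.PositionalGamesParityMonotoneQuasipolyUpperEmbedding
import Literature.Combinatorics.Games.ParityProgressMeasures
import Literature.Combinatorics.Games.ParityGameBridge

/-!
# Progress-measure lifting: completeness
(route PneNP/PositionalGames, support item stmt-PneNP-1298 `ParityMonotoneQuasipolyUpper`)

If Even wins positionally from `v` on a dead-end-free input with priorities `p u + 2 ≤ 2H`, every
iterate of lifting over `Val U` is finite at `v`, provided `U` contains the depth-`H` level of
`OrderedTree.univ kk H` and `|V| ≤ 2^kk - 1` (`iter_lt_top_of_evenWinsPositional`, `iter_lt_top_iff`).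
Proof: Zielonka's uniform positional solution (`Zielonka.exists_solution`) puts `v` in Even's region
`W`; Jurdziński's measure of the auxiliary game `auxGame` (`ParityGame.isProgressMeasure_measureOf`)
padded to length `H` spans a tree with `≤ |V|` leaves, which embeds into the universal tree
(`OrderedTree.isUniversal_univ`); the embedded labels (`⊤` off `W`) form a prefixpoint of lifting,
finite at `v` (Czerwiński et al. 2019, Thms 1–2; Jurdziński–Lazić 2017).
-/

namespace Summit.PneNP.PneNP.Theorems.ParityLifting

set_option linter.dupNamespace false -- `Summit.PneNP.PneNP.…`: summit = sub-problem (D-0017)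

open Literature.Combinatorics.Games

variable {U : Finset (List ℕ)} {V : Type*} [Fintype V]

/-! ## Completeness: from a positional win to a prefixpoint finite at `v` -/

section Complete

variable {o : V → Bool} {p : V → ℕ} {H : ℕ} {x : V × V → Bool}

open Zielonka

/-- **Zielonka's uniform positional solution of the encoded arena, and `v` lies in Even's
region** when Even wins positionally from `v` (otherwise Odd's positional strategy of the
solution would beat Even's). Edge priorities are `p u + 2` (source vertex). -/
theorem exists_solution_mem (hx : ∀ u, ∃ w, x (u, w) = o u) {v : V}
    (hwin : ParityGame.EvenWinsPositional o p (ParityGame.edgeOfBits o x) v) :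
    ∃ (W : Bool → Set V) (σ : Bool → V → V),
      Zielonka.Solution o (fun u _ => p u + 2)
        (Finset.univ.filter fun e : V × V => x e = o e.1) W σ ∧ v ∈ W true := by
  classical
  set E := Finset.univ.filter (fun e : V × V => x e = o e.1) with hE
  have hmem : ∀ u w, (u, w) ∈ E ↔ x (u, w) = o u := by simp [hE]
  have harena : IsArena E := fun e he => (hx e.2).imp fun w hw => (hmem _ _).2 hw
  obtain ⟨W, σ, sol⟩ := exists_solution o (fun u _ => p u + 2) E harena
  refine ⟨W, σ, sol, ?_⟩
  obtain ⟨w₀, hw₀⟩ := hx v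
  rcases sol.cover v w₀ ((hmem _ _).2 hw₀) with h | h
  · exact h
  · exfalso
    obtain ⟨σE, hσE, hwinE⟩ := hwin
    set τ := σ false with hτdef
    have hτ : ∀ u, o u = false → ParityGame.edgeOfBits o x u (τ u) := by
      intro u hu
      obtain ⟨w, hw⟩ := hx u
      have hl := sol.legal u w ((hmem _ _).2 hw)
      rw [hu] at hl
      exact (hmem _ _).1 hl
    have heven := hwinE τ hτ
    set ρ : ℕ → V := fun i => (positionalPlay o σE τ)^[i] v with hρ
    have hsucc : ∀ i, ρ (i + 1) = positionalPlay o σE τ (ρ i) := fun i =>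
      Function.iterate_succ_apply' _ _ _
    have hρE : ∀ i, (ρ i, ρ (i + 1)) ∈ E := by
      intro i
      rw [hmem, hsucc]
      by_cases ho : o (ρ i) = true
      · rw [positionalPlay_of_eq_true _ _ ho]
        exact hσE _ ho
      · rw [Bool.not_eq_true] at ho
        rw [positionalPlay_of_eq_false _ _ ho]
        exact hτ _ ho
    have hconf : ∀ i, o (ρ i) = false → ρ (i + 1) = σ false (ρ i) := by
      intro i ho
      rw [hsucc, positionalPlay_of_eq_false _ _ ho]
    have hW := sol.wins false ρ hρE h hconf
    have htop : topPrio (fun u _ => p u + 2) ρ = (infinitelyOften ρ).sup p + 2 := by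
      apply topPrio_eq
      · exact (frequently_eq_sup_infinitelyOften p ρ).mono fun i hi => by
          show p (ρ i) + 2 = _
          rw [hi]
      · exact (eventually_le_sup_infinitelyOften p ρ).mono fun i hi => by
          show p (ρ i) + 2 ≤ _
          omega
    unfold Zielonka.Wins at hW
    rw [htop, decide_eq_false_iff_not] at hW
    apply hW
    have hcyc : infinitelyOften ρ = lassoCycle o σE τ v := rfl
    rw [hcyc, Nat.even_add]
    exact iff_of_true heven even_two

variable {W : Set V} {σ : V → V}

/-- Successors of an Even vertex of `W` in the auxiliary game. -/
theorem auxGame_succ_even (hx : ∀ u, ∃ w, x (u, w) = o u) {u : V} (hu : u ∈ W) (ho : o u = true) :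
    (auxGame o p x W σ hx).succ u = {σ u} := by simp [auxGame, hu, ho]

/-- Successors of an Odd vertex of `W` in the auxiliary game. -/
theorem auxGame_succ_odd (hx : ∀ u, ∃ w, x (u, w) = o u) {u : V} (hu : u ∈ W) (ho : o u = false) :
    (auxGame o p x W σ hx).succ u = Finset.univ.filter fun w => x (u, w) = false := by
  simp [auxGame, hu, ho]

/-- Successors outside `W` in the auxiliary game. -/
theorem auxGame_succ_not_mem (hx : ∀ u, ∃ w, x (u, w) = o u) {u : V} (hu : u ∉ W) :
    (auxGame o p x W σ hx).succ u = {u} := by simp [auxGame, hu]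

/-- Priorities inside `W` in the auxiliary game. -/
theorem auxGame_prio_mem (hx : ∀ u, ∃ w, x (u, w) = o u) {u : V} (hu : u ∈ W) (w : V) :
    (auxGame o p x W σ hx).prio u w = p u + 2 := by simp [auxGame, hu]

/-- Priorities outside `W` in the auxiliary game. -/
theorem auxGame_prio_not_mem (hx : ∀ u, ∃ w, x (u, w) = o u) {u : V} (hu : u ∉ W) (w : V) :
    (auxGame o p x W σ hx).prio u w = 2 := by simp [auxGame, hu]

omit [Fintype V] in
/-- `auxStrat` inside `W`. -/
theorem auxStrat_of_mem {u : V} (hu : u ∈ W) : auxStrat W σ u = σ u := by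
  simp [auxStrat, hu]

omit [Fintype V] in
/-- `auxStrat` outside `W`. -/
theorem auxStrat_of_not_mem {u : V} (hu : u ∉ W) : auxStrat W σ u = u := by
  simp [auxStrat, hu]

/-- `auxStrat` is a legal positional strategy of the auxiliary game. -/
theorem isPositional_auxStrat (hx : ∀ u, ∃ w, x (u, w) = o u) :
    (auxGame o p x W σ hx).IsPositional (auxStrat W σ) := by
  classical
  intro u hu
  change o u = true at hu
  by_cases hW : u ∈ W
  · rw [auxGame_succ_even hx hW hu, auxStrat_of_mem hW]
    exact Finset.mem_singleton_self _
  · rw [auxGame_succ_not_mem hx hW, auxStrat_of_not_mem hW]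
    exact Finset.mem_singleton_self _

/-- `d` of the auxiliary game is at most `2H` when all priorities satisfy `p u + 2 ≤ 2H`. -/
theorem auxGame_d_le (hx : ∀ u, ∃ w, x (u, w) = o u) (hp : ∀ u, p u + 2 ≤ 2 * H) (hH : 1 ≤ H) :
    (auxGame o p x W σ hx).d ≤ 2 * H := by
  classical
  set G := auxGame o p x W σ hx
  have hm : (Finset.univ.sup fun v => (G.succ v).sup (G.prio v)) ≤ 2 * H := by
    apply Finset.sup_le
    intro u _
    apply Finset.sup_le
    intro w _
    by_cases hu : u ∈ W
    · rw [auxGame_prio_mem hx hu]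
      exact hp u
    · rw [auxGame_prio_not_mem hx hu]
      omega
  unfold Literature.Combinatorics.Games.ParityGame.d
  simp only
  omega

/-- **Every play of the auxiliary game conforming to `auxStrat` is won by Even**, when `W`, `σ`
come from a Zielonka solution (plays from `W` stay in `W` and are won there; plays from outside
sit on an even self-loop). -/
theorem auxGame_wins (hx : ∀ u, ∃ w, x (u, w) = o u) {Wb : Bool → Set V} {σb : Bool → V → V}
    (sol : Zielonka.Solution o (fun u _ => p u + 2)
      (Finset.univ.filter fun e : V × V => x e = o e.1) Wb σb)
    (hW : W = Wb true) (hσ : σ = σb true) (ρ : ℕ → V)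
    (hρ : (auxGame o p x W σ hx).IsPlay ρ) :
    Zielonka.Wins (auxGame o p x W σ hx).prio true ρ := by
  classical
  set E := Finset.univ.filter (fun e : V × V => x e = o e.1) with hE
  have hmem : ∀ u w, (u, w) ∈ E ↔ x (u, w) = o u := by simp [hE]
  by_cases h0 : ρ 0 ∈ W
  · -- the play stays in W, along E-edges, conforming to σ
    have hnext : ∀ u w, u ∈ W → w ∈ (auxGame o p x W σ hx).succ u →
        w ∈ W ∧ (u, w) ∈ E ∧ (o u = true → w = σb true u) := by
      intro u w hu hw
      by_cases ho : o u = true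
      · rw [auxGame_succ_even hx hu ho, Finset.mem_singleton] at hw
        subst hw
        obtain ⟨w', hw'⟩ := hx u
        have hl := sol.legal u w' ((hmem _ _).2 hw')
        rw [ho] at hl
        have hcl := sol.closed_self true u (hW ▸ hu) ho
        rw [← hW, ← hσ] at hcl
        rw [← hσ] at hl
        exact ⟨hcl, hl, fun _ => by rw [hσ]⟩
      · rw [Bool.not_eq_true] at ho
        rw [auxGame_succ_odd hx hu ho, Finset.mem_filter] at hw
        have he : (u, w) ∈ E := (hmem _ _).2 (by rw [hw.2, ho])
        have hcl := sol.closed_opp true u w (hW ▸ hu) (by rw [ho]; decide) he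
        rw [← hW] at hcl
        exact ⟨hcl, he, fun h => by rw [ho] at h; exact absurd h (by decide)⟩
    have hin : ∀ i, ρ i ∈ W := by
      intro i
      induction i with
      | zero => exact h0
      | succ i ih => exact (hnext _ _ ih (hρ i)).1
    have hfacts : ∀ i, (ρ i, ρ (i + 1)) ∈ E ∧ (o (ρ i) = true → ρ (i + 1) = σb true (ρ i)) :=
      fun i => (hnext _ _ (hin i) (hρ i)).2
    have hprio : ∀ i, (auxGame o p x W σ hx).prio (ρ i) (ρ (i + 1)) = p (ρ i) + 2 :=
      fun i => auxGame_prio_mem hx (hin i) _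
    have hW' := sol.wins true ρ (fun i => (hfacts i).1) (hW ▸ h0) (fun i ho => (hfacts i).2 ho)
    unfold Zielonka.Wins at hW' ⊢
    unfold Zielonka.topPrio at hW' ⊢
    simp_rw [hprio]
    exact hW'
  · -- the play sits on the self-loop at ρ 0
    have hconst : ∀ i, ρ i = ρ 0 := by
      intro i
      induction i with
      | zero => rfl
      | succ i ih =>
        have h := hρ i
        rw [ih, auxGame_succ_not_mem hx h0, Finset.mem_singleton] at h
        exact h
    have hprio : ∀ i, (auxGame o p x W σ hx).prio (ρ i) (ρ (i + 1)) = 2 := fun i => by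
      rw [hconst i, auxGame_prio_not_mem hx h0]
    unfold Zielonka.Wins
    rw [topPrio_eq (p := 2) (Filter.Frequently.of_forall hprio)
      (Filter.Eventually.of_forall fun i => (hprio i).le)]
    decide

/-- Arithmetic of the padding: with `d` even, `r + 2 ≤ d ≤ 2H`, the number of components seen by
priority `r` among labels of length `H` is the padding length plus the library's truncation
length for edge priority `r + 2`. -/
theorem tl_eq_pad_add {H d r : ℕ} (hd : d % 2 = 0) (hr : r + 2 ≤ d) (hdH : d ≤ 2 * H) :
    tl H r = (H - d / 2) + (d + 1 - (r + 2)) / 2 := by unfold tl; omega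

/-- **Labels.** If Even wins positionally from `v` on a dead-end-free input whose priorities
satisfy `p u + 2 ≤ 2H`, there are a region `W ∋ v`, closed under a legal positional strategy `σ`
of Even and under all present Odd moves, and labels of length `H` on it that are progressive (in
the `tl`/lexicographic sense) along every edge of the strategy subgraph inside `W`:
Zielonka's solution, Jurdziński's measure of the auxiliary game, padded in front by zeros. -/
theorem exists_labels (hx : ∀ u, ∃ w, x (u, w) = o u) (hp : ∀ u, p u + 2 ≤ 2 * H) {v : V}
    (hwin : ParityGame.EvenWinsPositional o p (ParityGame.edgeOfBits o x) v) :
    ∃ (W : Set V) (σ : V → V) (lab : V → List ℕ), v ∈ W ∧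
      (∀ u ∈ W, o u = true → x (u, σ u) = true ∧ σ u ∈ W) ∧
      (∀ u ∈ W, o u = false → ∀ w, x (u, w) = false → w ∈ W) ∧
      (∀ u ∈ W, (lab u).length = H) ∧
      (∀ u ∈ W, ∀ w, ((o u = true ∧ w = σ u) ∨ (o u = false ∧ x (u, w) = false)) →
        (lab w).take (tl H (p u)) ≤ (lab u).take (tl H (p u)) ∧
        (Odd (p u) → (lab w).take (tl H (p u)) < (lab u).take (tl H (p u)))) := by
  classical
  obtain ⟨Wb, σb, sol, hv⟩ := exists_solution_mem hx hwin
  set E := Finset.univ.filter (fun e : V × V => x e = o e.1) with hE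
  have hmem : ∀ u w, (u, w) ∈ E ↔ x (u, w) = o u := by simp [hE]
  set W := Wb true with hW
  set σ := σb true with hσ
  have hH : 1 ≤ H := by have := hp v; omega
  have hWE : ∀ u ∈ W, o u = true → x (u, σ u) = true ∧ σ u ∈ W := by
    intro u hu ho
    obtain ⟨w', hw'⟩ := hx u
    have hl := sol.legal u w' ((hmem _ _).2 hw')
    rw [ho] at hl
    exact ⟨by rw [← ho]; exact (hmem _ _).1 hl, sol.closed_self true u hu ho⟩
  have hWO : ∀ u ∈ W, o u = false → ∀ w, x (u, w) = false → w ∈ W := by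
    intro u hu ho w hw
    exact sol.closed_opp true u w hu (by rw [ho]; decide) ((hmem _ _).2 (by rw [hw, ho]))
  set G := auxGame o p x W σ hx with hG
  have hpos : G.IsPositional (auxStrat W σ) := isPositional_auxStrat hx
  have hplays : ∀ ρ : ℕ → V, G.IsPlay ρ →
      (∀ i, G.isEven (ρ i) = true → ρ (i + 1) = auxStrat W σ (ρ i)) →
      Zielonka.Wins G.prio true ρ :=
    fun ρ hρ _ => auxGame_wins hx sol rfl rfl ρ hρ
  have hpm := ParityGame.isProgressMeasure_measureOf hpos hplays
  set d := G.d with hd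
  have hd2 : d % 2 = 0 := G.d_mod_two
  have hdH : d ≤ 2 * H := auxGame_d_le hx hp hH
  set meas := G.measureOf (auxStrat W σ) with hmeas
  set lab : V → List ℕ := fun u => List.replicate (H - d / 2) 0 ++ meas u with hlab
  have hlenm : ∀ u, (meas u).length = d / 2 := hpm.length_eq
  refine ⟨W, σ, lab, hv, hWE, hWO, fun u _ => ?_, ?_⟩
  · simp only [hlab, List.length_append, List.length_replicate, hlenm]
    omega
  · intro u hu w hw
    -- the edge (u, w) is an edge of the strategy subgraph of the auxiliary game
    have hedge : G.StratEdge (auxStrat W σ) u w := by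
      rcases hw with ⟨ho, rfl⟩ | ⟨ho, hxw⟩
      · refine ⟨?_, fun _ => (auxStrat_of_mem hu).symm⟩
        rw [hG, auxGame_succ_even hx hu ho]
        exact Finset.mem_singleton_self _
      · refine ⟨?_, fun h => ?_⟩
        · rw [hG, auxGame_succ_odd hx hu ho]
          exact Finset.mem_filter.2 ⟨Finset.mem_univ _, hxw⟩
        · change o u = true at h
          rw [ho] at h
          exact absurd h (by decide)
    have hprio : G.prio u w = p u + 2 := auxGame_prio_mem hx hu w
    have hrd : p u + 2 ≤ d := hprio ▸ G.prio_le_d hedge.1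
    -- the truncations of the padded labels
    have hpad : ∀ z, (lab z).take (tl H (p u)) =
        List.replicate (H - d / 2) 0 ++ ParityGame.truncation d (p u + 2) (meas z) := by
      intro z
      simp only [hlab, ParityGame.truncation]
      rw [tl_eq_pad_add hd2 hrd hdH, List.take_append, List.take_of_length_le (by simp),
        List.length_replicate, Nat.add_sub_cancel_left]
    rw [hpad, hpad, append_le_append_left_iff, append_lt_append_left_iff]
    rcases Nat.even_or_odd (p u) with he | hodd
    · have h2 : Even (G.prio u w) := by rw [hprio, Nat.even_add]; exact iff_of_true he even_two
      have h := hpm.progress_even hedge h2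
      rw [hprio] at h
      refine ⟨not_lt.1 h, fun hodd => ?_⟩
      exact absurd hodd (Nat.not_odd_iff_even.2 he)
    · have h2 : Odd (G.prio u w) := by
        rw [hprio, Nat.odd_add]; exact iff_of_true hodd even_two
      have h := hpm.progress_odd hedge h2
      rw [hprio] at h
      exact ⟨le_of_lt h, fun _ => h⟩

/-- **Completeness: a prefixpoint finite at `v`.** With `U` containing the depth-`H` level of the
universal tree `OrderedTree.univ kk H` and `|V| ≤ 2^kk - 1`, the label tree of `exists_labels`
embeds into the universal tree, and the embedded labels (`⊤` outside `W`) form a prefixpoint of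
lifting, finite at `v`. -/
theorem exists_prefixpoint (hx : ∀ u, ∃ w, x (u, w) = o u) (hp : ∀ u, p u + 2 ≤ 2 * H) {kk : ℕ}
    (hU : ∀ l ∈ (OrderedTree.univ kk H).nodes, l.length = H → l ∈ U)
    (hV : Fintype.card V ≤ 2 ^ kk - 1) {v : V}
    (hwin : ParityGame.EvenWinsPositional o p (ParityGame.edgeOfBits o x) v) :
    ∃ ν : V → Val U, step o p H x ν ≤ ν ∧ ν v < ⊤ := by
  classical
  obtain ⟨W, σ, lab, hv, hWE, hWO, hlen, hprog⟩ := exists_labels hx hp hwin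
  set S := (Finset.univ.filter fun u => u ∈ W).image lab with hS
  have hlabS : ∀ u ∈ W, lab u ∈ S := fun u hu =>
    Finset.mem_image_of_mem lab (Finset.mem_filter.2 ⟨Finset.mem_univ _, hu⟩)
  have hSl : ∀ l ∈ S, l.length ≤ H := by
    intro l hl
    rw [hS, Finset.mem_image] at hl
    obtain ⟨u, hu, rfl⟩ := hl
    exact (hlen u (Finset.mem_filter.1 hu).2).le
  have hSne : S.Nonempty := ⟨lab v, hlabS v hv⟩
  set t := prefixTree S with ht
  have hth : t.height ≤ H := height_prefixTree_le hSl
  have htl : t.leaves.card ≤ 2 ^ kk - 1 :=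
    (card_leaves_prefixTree_le hSne).trans (Finset.card_image_le.trans
      ((Finset.card_filter_le _ _).trans (by rw [Finset.card_univ]; exact hV)))
  obtain ⟨f, hf⟩ := OrderedTree.isUniversal_univ kk H t hth htl
  have hnode : ∀ u ∈ W, lab u ∈ t.nodes := fun u hu => mem_prefixTree (hlabS u hu)
  have hfU : ∀ u ∈ W, f (lab u) ∈ U := fun u hu =>
    hU _ (hf.mapsTo (hnode u hu)) (by rw [hf.length_eq (hnode u hu), hlen u hu])
  set ν : V → Val U := fun u =>
    if hu : u ∈ W then (((⟨f (lab u), hfU u hu⟩ : {l // l ∈ U}) : WithBot {l // l ∈ U}) : Val U)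
    else ⊤ with hν
  have hνW : ∀ u (hu : u ∈ W), ν u =
      (((⟨f (lab u), hfU u hu⟩ : {l // l ∈ U}) : WithBot {l // l ∈ U}) : Val U) :=
    fun u hu => by simp [hν, hu]
  have hP : ∀ u ∈ W, ∀ w, ((o u = true ∧ w = σ u) ∨ (o u = false ∧ x (u, w) = false)) → w ∈ W →
      Prog (tl H (p u)) (decide (Odd (p u))) (ν u) (ν w) := by
    intro u hu w hw hwW
    obtain ⟨hle, hlt⟩ := hprog u hu w hw
    have hll : (lab w).length = (lab u).length := by rw [hlen w hwW, hlen u hu]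
    by_cases hodd : Odd (p u)
    · rw [decide_eq_true hodd, prog_true, hνW u hu, hνW w hwW, trunc_coe, trunc_coe,
        WithTop.coe_lt_coe, WithBot.coe_lt_coe]
      exact embedding_take_lt_take hf (hnode w hwW) (hnode u hu) hll (hlt hodd)
    · rw [decide_eq_false hodd, prog_false, hνW u hu, hνW w hwW, trunc_coe, trunc_coe,
        WithTop.coe_le_coe, WithBot.coe_le_coe]
      exact embedding_take_le_take hf (hnode w hwW) (hnode u hu) hll hle
  refine ⟨ν, fun u => ?_, by rw [hνW v hv]; exact WithTop.coe_lt_top _⟩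
  by_cases hu : u ∈ W
  · by_cases ho : o u = true
    · obtain ⟨hxσ, hσW⟩ := hWE u hu ho
      unfold step
      rw [if_pos ho]
      calc _ ≤ lift (tl H (p u)) (decide (Odd (p u))) (ν (σ u)) :=
            Finset.inf_le (f := fun w => lift (tl H (p u)) (decide (Odd (p u))) (ν w))
              (Finset.mem_filter.2 ⟨Finset.mem_univ _, hxσ⟩)
        _ ≤ ν u := lift_le_of_prog (hP u hu (σ u) (Or.inl ⟨ho, rfl⟩) hσW)
    · rw [Bool.not_eq_true] at ho
      unfold step
      rw [if_neg (by rw [ho]; decide)]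
      apply Finset.sup_le
      intro w hw
      have hxw := (Finset.mem_filter.1 hw).2
      exact lift_le_of_prog (hP u hu w (Or.inr ⟨ho, hxw⟩) (hWO u hu ho w hxw))
  · simp [hν, hu]

/-- **Completeness of lifting.** Under the hypotheses of `exists_prefixpoint`, if Even wins
positionally from `v` then every iterate of lifting is finite at `v`. -/
theorem iter_lt_top_of_evenWinsPositional (hx : ∀ u, ∃ w, x (u, w) = o u)
    (hp : ∀ u, p u + 2 ≤ 2 * H) {kk : ℕ}
    (hU : ∀ l ∈ (OrderedTree.univ kk H).nodes, l.length = H → l ∈ U)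
    (hV : Fintype.card V ≤ 2 ^ kk - 1) {v : V}
    (hwin : ParityGame.EvenWinsPositional o p (ParityGame.edgeOfBits o x) v) (k : ℕ) :
    iter (U := U) o p H x k v < ⊤ := by
  obtain ⟨ν, hν, hv⟩ := exists_prefixpoint hx hp hU hV hwin
  exact lt_of_le_of_lt (iter_le_of_step_le o p H x hν k v) hv

/-- **Correctness of lifting** (both directions): on a dead-end-free input with small priorities,
the stable iterate is finite at `v` iff Even wins positionally from `v`. -/
theorem iter_lt_top_iff (hx : ∀ u, ∃ w, x (u, w) = o u) (hp : ∀ u, p u + 2 ≤ 2 * H) {kk : ℕ}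
    (hU : ∀ l ∈ (OrderedTree.univ kk H).nodes, l.length = H → l ∈ U)
    (hV : Fintype.card V ≤ 2 ^ kk - 1) (v : V) :
    iter (U := U) o p H x (Fintype.card V * Fintype.card (Val U)) v < ⊤ ↔
      ParityGame.EvenWinsPositional o p (ParityGame.edgeOfBits o x) v :=
  ⟨evenWinsPositional_of_iter_lt_top hx, fun h => iter_lt_top_of_evenWinsPositional hx hp hU hV h _⟩

end Complete

end Summit.PneNP.PneNP.Theorems.ParityLifting
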